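import Literature.Topology.FourManifolds.CylinderCobordism
import Mathlib.Geometry.Manifold.Instances.Sphere
import HarnessLib

/-!
# The half-disc bundle `Sᵐ × H²` as a manifold with boundary (Kervaire–Milnor 1963, Lemma 2.4)

Topic `Literature/Topology/FourManifolds`. In the proof of Lemma 2.4 of Kervaire–Milnor, *Groups of
homotopy spheres I*, Ann. of Math. 77 (1963), p. 507, the contractible manifold bounded by
`M # (-M)` is glued from `(M - i(½Dⁿ)) × [0, π]` and the product `Sⁿ⁻¹ × H²` of a sphere with the
half-disc `H² = {(t sin θ, t cos θ) : 0 ≤ t ≤ 1, 0 ≤ θ ≤ π} = {(a, b) : a ≥ 0, a² + b² ≤ 1}`. This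
file builds the second piece, with the (irrelevant) outer arc removed so that no corners occur:
the **half-disc bundle** `Sᵐ × {(a, b) : a ≥ 0, a² + b² < 1}`, as a `C^∞` manifold with boundary
modelled on `𝓡∂ (m + 2)` whose boundary is the *diameter* `Sᵐ × {a = 0}`.

## Construction

It is the regular sublevel set `{F ≤ 0}`, `F (w, z) = -z₀`, of the boundaryless
`(m+2)`-manifold `Sᵐ × D` (`D ⊆ ℝ²` the open unit disc, an open submanifold of `ℝ²`; product model
`(𝓡 m).prod (𝓡 2)` transported to the model vector space `ℝ^{m+2}` along
`EuclideanSpace.finAddEquivProd`), in the form `RegularSublevelSetBoundaryless`/`CylinderCobordism`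
(`sublevelAtlasB`; Milnor, *Morse theory* (1963), Thm. 3.1). `F` is regular everywhere: along the
curve `s ↦ (w, z + δ s (1 + s²)^{-1/2} e₀)`, `δ = 1 - ‖z‖`, which stays in the open disc, it has
derivative `-δ ≠ 0` at `s = 0`.

## Main results

* `Literature.HalfDiscBundle.carrier m`, `instChartedSpace`, `instIsManifold`, `isBoundaryPoint_iff`
  (`↔ z₀ = 0`), `isSmoothEmbedding_subtype_val`, `contMDiff_subtype_val`.

## References

* M. Kervaire, J. Milnor, *Groups of homotopy spheres I*, Ann. of Math. 77 (1963), proof of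
  Lemma 2.4, p. 507. [KervaireMilnorAnnals1963]
* J. Milnor, *Morse theory* (1963), Thm. 3.1. [Milnor1963]
-/

open scoped Manifold ContDiff Topology
open Set Function

noncomputable section

namespace Literature.Topology.FourManifolds

/-- Local notation: `𝔼 n` is the model Euclidean space `EuclideanSpace ℝ (Fin n)`. -/
local notation "𝔼 " n:arg => EuclideanSpace ℝ (Fin n)
/-- Local notation: `ℍ n` is the model half-space `EuclideanHalfSpace n`. -/
local notation "ℍ " n:arg => EuclideanHalfSpace n
/-- Local notation: `𝕊 m` is the unit sphere in `EuclideanSpace ℝ (Fin (m + 1))`. -/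
local notation "𝕊 " m:arg => (Metric.sphere (0 : EuclideanSpace ℝ (Fin (m + 1))) 1)

namespace HalfDiscBundle

variable (m : ℕ)

/-- The open unit disc of `ℝ²`, as an open submanifold. [folklore] -/
def disc : TopologicalSpace.Opens (𝔼 2) := ⟨Metric.ball 0 1, Metric.isOpen_ball⟩

/-- Membership in the open unit disc. [folklore] -/
@[simp] theorem mem_disc_iff {z : 𝔼 2} : z ∈ disc ↔ ‖z‖ < 1 := by
  simp [disc]

/-- The model with corners of the boundaryless `(m+2)`-manifold `Sᵐ × D`: the product model with
its model vector space `ℝᵐ × ℝ²` transported to `ℝ^{m+2}` along `EuclideanSpace.finAddEquivProd`.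
[folklore] -/
abbrev model : ModelWithCorners ℝ (𝔼 (m + 2)) (ModelProd (𝔼 m) (𝔼 2)) :=
  ((𝓡 m).prod (𝓡 2)).transContinuousLinearEquiv (EuclideanSpace.finAddEquivProd (𝕜 := ℝ)).symm

/-- The transported product model is boundaryless. [folklore] -/
theorem boundaryless_model : (model m).Boundaryless :=
  boundaryless_transContinuousLinearEquiv _ _

/-- The height function `F (w, z) = -z₀` on `Sᵐ × D`. [folklore] -/
def height (p : (𝕊 m) × disc) : ℝ := -(p.2.1 0)

/-- The height function is smooth for the product model. [folklore] -/
theorem contMDiff_height_prod : ContMDiff ((𝓡 m).prod (𝓡 2)) 𝓘(ℝ, ℝ) ∞ (height m) := by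
  have h0 : ContDiff ℝ ∞ (fun z : 𝔼 2 => z 0) := by
    simpa using (EuclideanSpace.proj (0 : Fin 2) : 𝔼 2 →L[ℝ] ℝ).contDiff
  have h1 : ContMDiff (𝓡 2) 𝓘(ℝ, ℝ) ∞ (fun z : 𝔼 2 => -(z 0)) :=
    contMDiff_iff_contDiff.2 h0.neg
  exact h1.comp ((_root_.contMDiff_subtype_val).comp contMDiff_snd)

/-- The height function is smooth for the transported model. [folklore] -/
theorem contMDiff_height : ContMDiff (model m) 𝓘(ℝ, ℝ) ∞ (height m) :=
  ((EuclideanSpace.finAddEquivProd (𝕜 := ℝ)).symm.contMDiff_transContinuousLinearEquiv_left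
    (I := (𝓡 m).prod (𝓡 2))).2 (contMDiff_height_prod m)

/-- The bounded reparametrisation `c s = s / √(1 + s²)` of `ℝ` onto `(-1, 1)`: smooth, `|c s| < 1`,
`c 0 = 0`, `c' 0 = 1`. [folklore] -/
def squash (s : ℝ) : ℝ := s / Real.sqrt (1 + s ^ 2)

/-- `|squash s| < 1`. [folklore] -/
theorem abs_squash_lt_one (s : ℝ) : |squash s| < 1 := by
  have h1 : 0 < Real.sqrt (1 + s ^ 2) := Real.sqrt_pos.2 (by positivity)
  rw [squash, abs_div, abs_of_pos h1, div_lt_one h1]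
  have h2 : |s| = Real.sqrt (s ^ 2) := (Real.sqrt_sq_eq_abs s).symm
  rw [h2]
  exact Real.sqrt_lt_sqrt (sq_nonneg _) (by linarith)

/-- `squash` is smooth. [folklore] -/
theorem contDiff_squash : ContDiff ℝ ∞ squash := by
  refine contDiff_id.div ((contDiff_const.add (contDiff_id.pow 2)).sqrt fun s => ?_) fun s => ?_
  · simp only [id_eq]; positivity
  · exact (Real.sqrt_pos.2 (by positivity)).ne'

/-- `squash` has derivative `1` at `0`. [folklore] -/
theorem hasDerivAt_squash_zero : HasDerivAt squash 1 0 := by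
  have h1 : HasDerivAt (fun s : ℝ => Real.sqrt (1 + s ^ 2)) 0 0 := by
    have := ((hasDerivAt_const (0 : ℝ) (1 : ℝ)).add ((hasDerivAt_id (0 : ℝ)).pow 2)).sqrt
      (by norm_num)
    simpa using this
  have h2 := (hasDerivAt_id (0 : ℝ)).div h1 (by simp)
  simp at h2
  exact h2

/-- The vertical test curve through `(w, z)`: `s ↦ (w, z + δ · squash s · e₀)`, `δ = 1 - ‖z‖`,
which stays inside the open disc. [folklore] -/
def curve (p : (𝕊 m) × disc) (s : ℝ) : (𝕊 m) × disc :=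
  (p.1, ⟨p.2.1 + ((1 - ‖p.2.1‖) * squash s) • EuclideanSpace.single 0 1, by
    rw [mem_disc_iff]
    have hz : ‖p.2.1‖ < 1 := mem_disc_iff.1 p.2.2
    have hδ : 0 < 1 - ‖p.2.1‖ := by linarith
    calc ‖p.2.1 + ((1 - ‖p.2.1‖) * squash s) • EuclideanSpace.single (0 : Fin 2) (1 : ℝ)‖
        ≤ ‖p.2.1‖ + ‖((1 - ‖p.2.1‖) * squash s) • EuclideanSpace.single (0 : Fin 2) (1 : ℝ)‖ :=
          norm_add_le _ _
      _ = ‖p.2.1‖ + (1 - ‖p.2.1‖) * |squash s| := by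
          rw [norm_smul, PiLp.norm_single, norm_one, mul_one, Real.norm_eq_abs, abs_mul,
            abs_of_pos hδ]
      _ < ‖p.2.1‖ + (1 - ‖p.2.1‖) * 1 := by gcongr; exact abs_squash_lt_one s
      _ = 1 := by ring⟩)

/-- The test curve passes through `p` at `s = 0`. [folklore] -/
theorem curve_zero (p : (𝕊 m) × disc) : curve m p 0 = p := by
  ext : 1
  · rfl
  · apply Subtype.ext
    simp [curve, squash]

/-- The test curve is smooth (product model). [folklore] -/
theorem contMDiff_curve (p : (𝕊 m) × disc) :
    ContMDiff 𝓘(ℝ, ℝ) ((𝓡 m).prod (𝓡 2)) ∞ (curve m p) := by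
  refine contMDiff_const.prodMk ?_
  rw [← ContMDiff.subtypeVal_comp_iff]
  show ContMDiff 𝓘(ℝ, ℝ) (𝓡 2) ∞ fun s => p.2.1 + ((1 - ‖p.2.1‖) * squash s) •
    EuclideanSpace.single (0 : Fin 2) (1 : ℝ)
  exact contMDiff_iff_contDiff.2 (contDiff_const.add
    ((contDiff_const.mul contDiff_squash).smul contDiff_const))

/-- The height along the test curve: `F (curve s) = -(z₀ + δ · squash s)`. [folklore] -/
theorem height_curve (p : (𝕊 m) × disc) (s : ℝ) :
    height m (curve m p s) = -(p.2.1 0 + (1 - ‖p.2.1‖) * squash s) := by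
  simp [height, curve]

/-- **The height function is regular everywhere** (its derivative along the vertical test curve
at `s = 0` is `-(1 - ‖z‖) ≠ 0`). [folklore] -/
theorem not_isMCriticalPt_height (p : (𝕊 m) × disc) : ¬ IsMCriticalPt (model m) (height m) p := by
  rw [isMCriticalPt_transContinuousLinearEquiv_iff _ _
    ((contMDiff_height_prod m).contMDiffAt.of_le (by exact_mod_cast le_top))]
  intro hc
  have hz : ‖p.2.1‖ < 1 := mem_disc_iff.1 p.2.2
  have hd1 : MDifferentiableAt ((𝓡 m).prod (𝓡 2)) 𝓘(ℝ, ℝ) (height m) (curve m p 0) := by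
    rw [curve_zero]; exact (contMDiff_height_prod m).mdifferentiableAt (by simp)
  have hd2 : MDifferentiableAt 𝓘(ℝ, ℝ) ((𝓡 m).prod (𝓡 2)) (curve m p) 0 :=
    (contMDiff_curve m p).mdifferentiableAt (by simp)
  have hcomp : mfderiv 𝓘(ℝ, ℝ) 𝓘(ℝ, ℝ) (height m ∘ curve m p) 0 = 0 := by
    rw [mfderiv_comp (0 : ℝ) hd1 hd2, curve_zero]
    rw [IsMCriticalPt] at hc
    rw [hc, ContinuousLinearMap.zero_comp]
    rfl
  have hg : HasDerivAt (height m ∘ curve m p) (-((1 - ‖p.2.1‖) * 1)) 0 := by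
    have h := ((hasDerivAt_squash_zero.const_mul (1 - ‖p.2.1‖)).const_add (p.2.1 0)).neg
    refine h.congr_of_eventuallyEq (Filter.Eventually.of_forall fun s => ?_)
    exact height_curve m p s
  rw [mfderiv_eq_fderiv] at hcomp
  erw [hg.hasFDerivAt.fderiv] at hcomp
  have h1 : (-((1 - ‖p.2.1‖) * 1) : ℝ) = 0 := by
    have := DFunLike.congr_fun hcomp (1 : ℝ)
    change (1 : ℝ) • (-((1 - ‖p.2.1‖) * 1)) = (0 : ℝ) at this
    rwa [one_smul] at this
  linarith

/-! ### The half-disc bundle as a regular sublevel set -/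

/-- The half-disc bundle `Sᵐ × {z ∈ D : z₀ ≥ 0}`, as the subset `{F ≤ 0}` of `Sᵐ × D`.
[folklore] -/
def carrier : Set ((𝕊 m) × disc) := height m ⁻¹' Iic 0

/-- `(w, z)` lies in the half-disc bundle iff `0 ≤ z₀`. [folklore] -/
theorem mem_carrier_iff {p : (𝕊 m) × disc} : p ∈ carrier m ↔ 0 ≤ p.2.1 0 := by
  simp [carrier, height]

/-- **The half-slice atlas of the half-disc bundle** (`sublevelAtlasB`; Milnor, *Morse theory*
(1963), Thm. 3.1). [cite: Milnor1963, Thm. 3.1] -/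
def atlas : HalfSliceAtlas (model m) (carrier m) :=
  haveI := boundaryless_model m
  sublevelAtlasB (contMDiff_height m) 0 (fun p _ => not_isMCriticalPt_height m p)

/-- The charts of the half-disc bundle, modelled on the half-space `ℍ^{m+2}`. [folklore] -/
instance instChartedSpace : ChartedSpace (ℍ (m + 2)) ↥(carrier m) := (atlas m).chartedSpace

/-- The half-disc bundle is a `C^∞` manifold with boundary. [folklore] -/
instance instIsManifold : IsManifold (𝓡∂ (m + 2)) ∞ ↥(carrier m) := (atlas m).isManifold

/-- **The boundary of the half-disc bundle is the diameter** `Sᵐ × {z₀ = 0}`. [folklore] -/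
theorem isBoundaryPoint_iff (p : ↥(carrier m)) :
    (𝓡∂ (m + 2)).IsBoundaryPoint p ↔ p.1.2.1 0 = 0 := by
  haveI := boundaryless_model m
  refine (isBoundaryPoint_sublevelB_iff (contMDiff_height m) 0
    (fun p _ => not_isMCriticalPt_height m p) p).trans ?_
  simp [height]

/-- The inclusion of the half-disc bundle in `Sᵐ × D` is a smooth embedding (transported
product model). [folklore] -/
theorem isSmoothEmbedding_subtype_val :
    Manifold.IsSmoothEmbedding (𝓡∂ (m + 2)) (model m) ∞ (Subtype.val : ↥(carrier m) → (𝕊 m) × disc) :=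
  haveI := boundaryless_model m
  (atlas m).isSmoothEmbedding_subtype_val_of_boundaryless

/-- The inclusion of the half-disc bundle in `Sᵐ × D` is smooth for the product model.
[folklore] -/
theorem contMDiff_subtype_val :
    ContMDiff (𝓡∂ (m + 2)) ((𝓡 m).prod (𝓡 2)) ∞ (Subtype.val : ↥(carrier m) → (𝕊 m) × disc) :=
  haveI := boundaryless_model m
  ((EuclideanSpace.finAddEquivProd (𝕜 := ℝ)).symm.contMDiff_transContinuousLinearEquiv_right
    (I := (𝓡 m).prod (𝓡 2))).1 (atlas m).contMDiff_subtype_val_of_boundaryless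

end HalfDiscBundle

end Literature.Topology.FourManifolds
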